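import Summits.ABC.IUTFork.LDHTensor
import Literature.IUT.LogVolume.WildShellObstructionUnits
import HarnessLib

/-!
# The fork at [IUTchIII] Corollary 3.12, L-DH level: in Dupuy–Hilado's shell normalisation the real datum
# `PrimePacket.realDHDatum` is UNINHABITED over any local-field family with a wild cubic factor at a place
# outside the support of the theta pilot (kernel form of R7-C3-Q1, row 1)

Proof-only companion (theorems, no definitions) of `LDHTensor.lean` (abc-iut cell, seat abc-iut-c312-3), written
by seat abc-iut-w5-d069 over its `WildShellObstructionUnits.lean`. TAKES NO SIDE on [IUTchIII] Cor. 3.12.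

`LDHTensor.lean` records two normalisations of the (Ind3)-bound of a Dupuy–Hilado datum at a prime
(Dupuy–Hilado, arXiv:2004.13228 (pre-split text) §4 intro "`I_{v̲} = (1/2p_{v̲}) log(O^×_{v̲})`", (4.10)
"`(q̲_{v̲}^{j²/2l})^ℕ · Peel^j_{v̲} I^{⊗ j+1}`"; [IUTchIV] Prop. 1.2 (ii), kurims p. 10, "In particular,
`φ((R_I)^∼) ⊆ p^{−⌈d_I+a_I⌉}·log_p(R_I^×)`"): `PrimePacket.realDHDatum` (shell `I_{v⃗}`, the (Ind3)-region an
INPUT) and `PrimePacket.minimalDHDatumM` (Mochizuki's container, the minimal region from the ideles alone), with the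
docstring remark that the former's input "may not exist for wild `𝔽`". This file makes that remark a theorem:

* `PrimePacket.not_nonempty_dhDatum_realPrimePacket_of_wildCubic` / `…isEmpty…` — for `p = 3`, ANY number field
  `F`, pilot data `X`, local-field family `𝔽 : LocalFields F 3` and place `v | 3` with `v ∉ X.S` such that
  `[𝔽.k v : ℚ₃] = 3` and `𝔽.k v ∋ π`, `π³ = 3`: the type `(realPrimePacket 3 𝔽).DHDatum X` is EMPTY. Reason: its
  fields `tΘ_ord` (the theta idele at `v ∉ Supp P_Θ` is a unit `t`), `region_subset` and `subset_bound` at degree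
  `j = 1` and the tuple `(v, v)` give `ι₁(t)·(R_I)^∼ ⊆ bare3 ⊆ ⋃ₙ ι₁(t)ⁿ·I_{v⃗}`, contradicting
  `not_iota_smul_normalizedPacket_subset_iUnion_logShell`.
* `PrimePacket.nonempty_dhDatum_realPrimePacketM` — whereas in Mochizuki's normalisation a datum exists from any
  ideles with the pinned valuations (`minimalDHDatumM`, restated for contrast).

HONEST SCOPE. The interface `LocalFields F 3` admits a wild cubic factor `ℚ₃(∛3)`; the completions `K_{v̲}` of an
actual field of initial Θ-data ([IUTchI] Def. 3.1: `K = F(E[l])`, `F ∋ √−1`, …) have much larger degree, and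
whether THEY meet the same obstruction is not claimed here. What is kernel-checked: the DH-normalised (4.10)-bound
is not satisfiable uniformly in `𝔽`, so `DHData.ofTensor` needs its (Ind3)-region input, while `DHData.ofIdelesM`
does not (planner ruling R6-a: both readings stay typed). [cite: DupuyHilado2025, §4 (intro), §4.10]
[cite: Mochizuki2012, IUTchIV Prop. 1.2 (ii) p. 10] [claim: Mochizuki2012, status: disputed] Nothing asserted
about Cor. 3.12; which normalisation [IUTchIII] Thm. 3.11 (ii) (Ind3) means is not decided here.
-/

noncomputable section

open Set
open scoped Pointwise

namespace Literature.IUT.LogVolume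

namespace PrimePacket

open NumberField IsDedekindDomain

variable {F : Type} [Field F] [NumberField F]

/-- An idele component with `ord_v = 0` is a unit of norm one (`ord_v(a) = −e_v·log‖a‖/log p`).
[cite: DupuyHilado2025, §2.4.2, §3.4] -/
theorem norm_eq_one_of_ordv_eq_zero {p : ℕ} [Fact p.Prime] (𝔽 : LocalFields F p) {v : placesOver F p}
    (a : (𝔽.k v)ˣ) (h : 𝔽.ordv a = 0) : ‖(a : 𝔽.k v)‖ = 1 := by
  have hp : (1 : ℝ) < p := by exact_mod_cast (Fact.out : p.Prime).one_lt
  have hlogp : Real.log p ≠ 0 := (Real.log_pos hp).ne'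
  have he : (ramIdx F v.1 : ℝ) ≠ 0 := by exact_mod_cast ramIdx_ne_zero F v.1
  have ha : 0 < ‖(a : 𝔽.k v)‖ := norm_pos_iff.mpr a.ne_zero
  unfold LocalFields.ordv at h
  have hlog : Real.log ‖(a : 𝔽.k v)‖ = 0 := by
    field_simp at h
    simpa [he] using h
  rcases Real.log_eq_zero.mp hlog with h0 | h1 | hm1
  · exact absurd h0 ha.ne'
  · exact h1
  · linarith [norm_nonneg (a : 𝔽.k v)]

/-- **No Dupuy–Hilado datum in the DH normalisation over a family with a wild cubic factor off `Supp P_Θ`.**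
For `𝔽 : LocalFields F 3`, a place `v | 3` with `v ∉ X.S`, `[𝔽.k v : ℚ₃] = 3` and `π ∈ 𝔽.k v` with `π³ = 3`:
`(realPrimePacket 3 𝔽).DHDatum X` has no element (its `tΘ_ord`, `region_subset`, `subset_bound` at `j = 1`,
`v⃗ = (v, v)` are jointly unsatisfiable). [cite: DupuyHilado2025, §4.10] [cite: Mochizuki2012, IUTchIV Prop. 1.2 (ii) p. 10] -/
theorem not_nonempty_dhDatum_realPrimePacket_of_wildCubic (𝔽 : LocalFields F 3) (X : PilotData F)
    (v : placesOver F 3) (hv : v.1 ∉ X.S) (hK : Module.finrank ℚ_[3] (𝔽.k v) = 3) {π : 𝔽.k v}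
    (hπ : π ^ 3 = 3) : ¬ Nonempty ((realPrimePacket 3 𝔽).DHDatum X) := by
  rintro ⟨d⟩
  have hl : 1 - 1 < X.lstar := by have := X.two_le_lstar; omega
  set i : Fin X.lstar := ⟨1 - 1, hl⟩ with hi
  let e : Fin ((i : ℕ) + 1 + 1) → placesOver F 3 := fun _ => v
  -- the theta idele at `v ∉ S` is a unit
  set t : (𝔽.k v)ˣ := d.tΘ i v with ht_def
  have hord : 𝔽.ordv t = 0 := by
    have h := d.tΘ_ord i v
    -- off the support `S` the theta pilot has coefficient `0` (cf. `DHData.thetaPilot_eq_zero_of_not_mem`)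
    have h0 : X.thetaPilot i v.1 = 0 := by
      classical
      show (∑ w ∈ X.S, FinDivisor.of w ((((i : ℕ) + 1 : ℝ) ^ 2) * (X.ordq w : ℝ) / (2 * X.l))) v.1 = 0
      rw [Finsupp.finsetSum_apply]
      refine Finset.sum_eq_zero fun w hw => ?_
      rw [FinDivisor.of, Finsupp.single_apply, if_neg]
      rintro rfl
      exact hv hw
    rw [h0] at h
    exact h
  have ht : ‖(t : 𝔽.k v)‖ = 1 := norm_eq_one_of_ordv_eq_zero 𝔽 t hord
  -- `region_subset` at degree `1`, tuple `(v, v)`: `ι₁(t)·(R_I)^∼ ⊆ bare3`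
  have hcond : 0 < (i : ℕ) + 1 ∧ (i : ℕ) + 1 - 1 < X.lstar := ⟨Nat.succ_pos _, by simpa [hi] using hl⟩
  have hreg := d.region_subset ((i : ℕ) + 1) e
  have hreg' : (realPrimePacket 3 𝔽).peel (d.tΘ ⟨(i : ℕ) + 1 - 1, hcond.2⟩ (e (Fin.last _))) ''
      (realPrimePacket 3 𝔽).O ((i : ℕ) + 1) e ⊆ d.bare3 ((i : ℕ) + 1) e := by
    have h := hreg
    unfold PrimePacket.regionOf at h
    rw [dif_pos hcond] at h
    exact h
  -- `subset_bound`: `bare3 ⊆ ⋃ₙ ι₁(t)ⁿ·I_{v⃗}`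
  have hbd := d.subset_bound i e
  have hidx : (⟨(i : ℕ) + 1 - 1, hcond.2⟩ : Fin X.lstar) = i := Fin.ext (by simp [hi])
  rw [hidx] at hreg'
  -- both in terms of the constant family `fun _ => 𝔽.k v` and the unit `t`
  have hsub : iota 3 (fun _ : Fin 2 => 𝔽.k v) 1 (t : 𝔽.k v) •
        (normalizedPacket 3 (fun _ : Fin 2 => 𝔽.k v) : Set (PacketAlgebra 3 (fun _ : Fin 2 => 𝔽.k v))) ⊆
      ⋃ n : ℕ, (fun x => iota 3 (fun _ : Fin 2 => 𝔽.k v) 1 (t : 𝔽.k v) * x)^[n] ''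
        logShell 3 (fun _ : Fin 2 => 𝔽.k v) := by
    rw [← Set.image_smul]
    exact hreg'.trans hbd
  exact not_iota_smul_normalizedPacket_subset_iUnion_logShell hK hπ ht hsub

/-- The same, as `IsEmpty`. [cite: DupuyHilado2025, §4.10] -/
theorem isEmpty_dhDatum_realPrimePacket_of_wildCubic (𝔽 : LocalFields F 3) (X : PilotData F)
    (v : placesOver F 3) (hv : v.1 ∉ X.S) (hK : Module.finrank ℚ_[3] (𝔽.k v) = 3) {π : 𝔽.k v}
    (hπ : π ^ 3 = 3) : IsEmpty ((realPrimePacket 3 𝔽).DHDatum X) :=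
  not_nonempty_iff.mp (not_nonempty_dhDatum_realPrimePacket_of_wildCubic 𝔽 X v hv hK hπ)

/-- **Contrast: in Mochizuki's normalisation a datum exists from the ideles alone** (`minimalDHDatumM` of
`LDHTensor.lean`, restated): whenever each `K_{v̲}`, `v | p`, carries elements with the pinned valuations, the
type `(realPrimePacketM p 𝔽).DHDatum X` is inhabited — also over families with wild factors.
[cite: Mochizuki2012, IUTchIV Prop. 1.2 (ii) p. 10] -/
theorem nonempty_dhDatum_realPrimePacketM {p : ℕ} [Fact p.Prime] (𝔽 : LocalFields F p) (X : PilotData F)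
    (tΘ : Fin X.lstar → (v : placesOver F p) → (𝔽.k v)ˣ)
    (tΘ_ord : ∀ (i : Fin X.lstar) (v : placesOver F p), 𝔽.ordv (tΘ i v) = X.thetaPilot i v.1)
    (tq : Fin X.lstar → (v : placesOver F p) → (𝔽.k v)ˣ)
    (tq_ord : ∀ (i : Fin X.lstar) (v : placesOver F p), 𝔽.ordv (tq i v) = X.qPilot v.1) :
    Nonempty ((realPrimePacketM p 𝔽).DHDatum X) :=
  ⟨minimalDHDatumM 𝔽 X tΘ tΘ_ord tq tq_ord⟩

end PrimePacket

end Literature.IUT.LogVolume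

end
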